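import Summits.CriticalPhenomena.PercolationContinuityZ3.Theses.PercHyperscalingGluing

/-!
# Route PercHyperscalingGluing — support item `CerfShortcut` (stmt-CriticalPhenomena-4647)

Cerf's linear-scale in-box long-range order hypothesis `X_D` ("`θ(p) > 0` gives `ρ > 0` and
`K` with `ρ ≤ P_p(x ↔ y inside Λ_{Kn})` for all `x, y ∈ Λ_n`, `n ≥ 1`"), together with free-box
shattering `F_r := |Λ_r|⁻¹ Σ_{x∈Λ_r} P_{p_c}(0 ↔ x inside Λ_r) → 0`, already yields
`θ(p_c) = 0` on `ℤ³` (`PercolationContinuityZ3`): if `θ(p_c) > 0`, apply `X_D` at `p = p_c`;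
`K = 0` is absurd (the event `{x ↔ x inside Λ_0}` is empty for `x = (1,1,1) ∈ Λ_1`), and for
`K ≥ 1` one gets `F_{Kn} ≥ |Λ_n| ρ / |Λ_{Kn}| ≥ ρ / K³` for every `n ≥ 1`, contradicting
`F_{Kn} → 0`. This records that the renormalisation crux of route PercFiniteBoxLRO is superfluous
once the free box shatters (Cerf 2015, p. 4; Hutchcroft 2022, p. 5).
-/

namespace Summit.CriticalPhenomena.PercolationContinuityZ3.Theorems

open Filter Topology MeasureTheory
open Literature.Probability.Percolation Literature.Probability.LatticeModels

/-- **Cerf's shortcut** (support item `CerfShortcut` of route PercHyperscalingGluing):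
linear-scale in-box long-range order from `θ > 0` (Cerf's `X_D`) and free-box shattering at
`p_c` together imply `θ(p_c) = 0` on `ℤ³`. Proof: by contradiction, `θ(p_c) > 0` and `X_D` give
`ρ > 0`, `K` with `ρ ≤ P_{p_c}(x ↔ y inside Λ_{Kn})` on `Λ_n × Λ_n`; `K = 0` is impossible
(empty event at `x = y = (1,1,1)`, `n = 1`), and for `K ≥ 1` summing over `y ∈ Λ_n ⊆ Λ_{Kn}` with
`x = 0` gives `F_{Kn} ≥ ρ |Λ_n| / |Λ_{Kn}| ≥ ρ / K³`, so `F_{Kn} ↛ 0`. -/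
theorem cerfShortcut_proof :
    Summit.CriticalPhenomena.PercolationContinuityZ3.Theses.PercHyperscalingGluing.CerfShortcut := by
  unfold Summit.CriticalPhenomena.PercolationContinuityZ3.Theses.PercHyperscalingGluing.CerfShortcut
  intro hX hF
  show theta (zdGraph 3) 0 (criticalProbI 3) = 0
  by_contra hne
  have hθpos : 0 < theta (zdGraph 3) 0 (criticalProbI 3) :=
    lt_of_le_of_ne measureReal_nonneg (Ne.symm hne)
  obtain ⟨ρ, hρ, K, hK⟩ := hX _ hθpos
  -- notation
  set P : Measure (BondConfig (Site 3)) := bondPercolation (zdGraph 3) (criticalProbI 3) with hP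
  set F : ℕ → ℝ := fun r : ℕ => ((box 3 r).card : ℝ)⁻¹ *
      ∑ x ∈ box 3 r, P.real (openConnIn ↑(box 3 r) 0 x) with hFdef
  have hF' : Tendsto F atTop (𝓝 0) := hF
  rcases Nat.eq_zero_or_pos K with hK0 | hKpos
  · -- `K = 0`: the event `{e ↔ e inside Λ_0}` with `e = (1,1,1) ∈ Λ_1 \ Λ_0` is empty.
    subst hK0
    have he : (fun _ => (1 : ℤ) : Site 3) ∈ box 3 1 := by
      rw [mem_box]; intro i; constructor <;> norm_num
    have h := hK 1 le_rfl _ he _ he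
    have hempty : openConnIn (↑(box 3 (0 * 1))) (fun _ => (1 : ℤ) : Site 3) (fun _ => (1 : ℤ))
        = (∅ : Set (BondConfig (Site 3))) := by
      ext ω
      simp only [openConnIn, Set.mem_setOf_eq, Set.mem_empty_iff_false, iff_false]
      rintro ⟨hx, -, -⟩
      rw [zero_mul, Finset.mem_coe, mem_box] at hx
      have h0 := (hx 0).2
      norm_num at h0
    rw [hempty, measureReal_empty] at h
    exact absurd h (not_le.2 hρ)
  · -- `K ≥ 1`: `F (K n) ≥ ρ / K³` for all `n ≥ 1`, contradicting `F (K n) → 0`.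
    have hK1 : 1 ≤ K := hKpos
    have hcard : ∀ L : ℕ, ((box 3 L).card : ℝ) = (2 * (L : ℝ) + 1) ^ 3 := by
      intro L
      rw [card_box]; push_cast; ring
    have hcard_pos : ∀ L : ℕ, (0 : ℝ) < ((box 3 L).card : ℝ) := by
      intro L; rw [hcard]; positivity
    have hratio : ∀ n : ℕ, ((box 3 (K * n)).card : ℝ) ≤ (K : ℝ) ^ 3 * ((box 3 n).card : ℝ) := by
      intro n
      rw [hcard, hcard, ← mul_pow]
      push_cast
      have hK1' : (1 : ℝ) ≤ K := by exact_mod_cast hK1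
      have hn0 : (0 : ℝ) ≤ n := Nat.cast_nonneg n
      apply pow_le_pow_left₀ (by positivity)
      nlinarith
    have key : ∀ n : ℕ, 1 ≤ n → ρ / (K : ℝ) ^ 3 ≤ F (K * n) := by
      intro n hn
      have hsub : box 3 n ⊆ box 3 (K * n) :=
        box_mono 3 (le_mul_of_one_le_left (Nat.zero_le n) hK1)
      -- lower bound on the sum over the big box by the sum over the small box
      have h1 : ∑ x ∈ box 3 n, P.real (openConnIn ↑(box 3 (K * n)) 0 x)
          ≤ ∑ x ∈ box 3 (K * n), P.real (openConnIn ↑(box 3 (K * n)) 0 x) :=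
        Finset.sum_le_sum_of_subset_of_nonneg hsub fun _ _ _ => measureReal_nonneg
      -- each term of the small sum is at least ρ
      have h2 : ∑ x ∈ box 3 n, ρ ≤ ∑ x ∈ box 3 n, P.real (openConnIn ↑(box 3 (K * n)) 0 x) :=
        Finset.sum_le_sum fun x hx => hK n hn 0 (zero_mem_box 3 n) x hx
      rw [Finset.sum_const, nsmul_eq_mul] at h2
      have h3 : ((box 3 n).card : ℝ) * ρ ≤ ((box 3 (K * n)).card : ℝ) * F (K * n) := by
        have h4 : ((box 3 (K * n)).card : ℝ) * F (K * n)
            = ∑ x ∈ box 3 (K * n), P.real (openConnIn ↑(box 3 (K * n)) 0 x) := by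
          simp only [hFdef]
          rw [← mul_assoc, mul_inv_cancel₀ (hcard_pos (K * n)).ne', one_mul]
        rw [h4]; exact h2.trans h1
      have hKpow : (0 : ℝ) < (K : ℝ) ^ 3 := by positivity
      rw [div_le_iff₀ hKpow]
      have hFn : 0 ≤ F (K * n) := by
        simp only [hFdef]
        exact mul_nonneg (inv_nonneg.2 (hcard_pos _).le)
          (Finset.sum_nonneg fun _ _ => measureReal_nonneg)
      -- ρ |Λ_n| ≤ |Λ_{Kn}| F(Kn) ≤ K³ |Λ_n| F(Kn)
      have h5 : ((box 3 n).card : ℝ) * ρ ≤ (K : ℝ) ^ 3 * ((box 3 n).card : ℝ) * F (K * n) :=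
        h3.trans (mul_le_mul_of_nonneg_right (hratio n) hFn)
      have ha := hcard_pos n
      nlinarith
    have hKn : Tendsto (fun n : ℕ => K * n) atTop atTop :=
      tendsto_atTop_mono (fun n => le_mul_of_one_le_left (Nat.zero_le n) hK1) tendsto_id
    have hlim : Tendsto (fun n : ℕ => F (K * n)) atTop (𝓝 0) := hF'.comp hKn
    have hle : ρ / (K : ℝ) ^ 3 ≤ 0 := ge_of_tendsto hlim (eventually_atTop.2 ⟨1, key⟩)
    have hpos : 0 < ρ / (K : ℝ) ^ 3 := by positivity
    exact absurd hle (not_le.2 hpos)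

end Summit.CriticalPhenomena.PercolationContinuityZ3.Theorems
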